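import Summits.QuantumFields.BalabanUV.Beta.EriceRemainderEnclosureHistoryAutonomyComparisonDualChainCriterion
import Summits.QuantumFields.BalabanUV.Beta.EriceRemainderEnclosureHistoryAutonomyComparisonTowerChainTen

/-!
# EriceRemainderEnclosureHistoryAutonomyComparisonTowerTen — (E65h) EVERY FINITE SET OF AGES WITH PAIRWISE RATIOS `≥ 10` COMPARES AT ANY SIZE, WHATEVER ITS
# CARDINALITY: `B(u) = b + Σ_{k<K} L_k·u_k` on ]0,γ] (`b > 0`, `L ≥ 0` supported on `{0} ∪ A`, `A ⊆ [1,K[` with `10·k ≤ k′` for `k < k′` in `A` — `#A`, the sizes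
# AND the Markov weight `L_0` ARBITRARY); `B′ ≥ B` with a zeroth moment and an ISOTONE excess ⟹ ANY box solutions from one pin satisfy `h′ ≤ h` at EVERY
# scale.  The first END theorem through the budgeted pipeline (E65a) → (E65b) → (E65e) → (E65f) → (E65g): trajectory → window budget → greedy dual
# certificate → dual chain → one polynomial inequality.  (E64g)∕(E64h) needed ratio `14` (oldest-first primal bookkeeping, no budget)

Cell `pub-balaban`, β-function sub-cell, BINDER row D4 «RemainderConst leaves for Bałaban's split» (`HOME/BINDER-OWNERS.md`; owner lineage `b2b-balaban-beta-an4`;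
this file by co-owner #2 lineage `b2b-balaban-beta-d4-p2`, generation 58), β-FLOW TEAM duty (1), FREEZE (0) honoured (def-free; (E65f)'s
`le_of_isotone_excess_of_budgeted_dual_chain`, (E65g)'s `dual_chain_of_tower_ten`, (E65b)'s `le_of_isotone_excess_budgeted_certificate`, (E65a)'s
`mul_sqrt_le_readWindow` ∕ `readWindow_nonneg` BY NAME; nothing restated).

HONEST FRAMING (page 1, verbatim and binding).  *"Discharging BetaPertH makes Bałaban's UV stability UNCONDITIONAL — a real constructive-QFT result; it is
NOT the continuum limit and NOT the Clay problem."*  THIS FILE DISCHARGES NOTHING OF THE KIND.  Elementary real analysis about ABSTRACT affine functionals on a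
box ]0,γ]^ℕ with displayed supports and signs — hypotheses of a census, not facts; the form, signs, ages and moments of Bałaban's (1.22) limit functional are
NOT PRINTED ([I] p. 298; GAPS G-t4-U2-1∕-2) and NOT asserted.  Row D4 class UNCHANGED (critical-path width 0; instance 0∕1; D4 DISCHARGE NO DATE).  HONEST
DEPENDENCY: continuum YM on T⁴ ⇐ BetaPertH ∧ nine spine estimates (0/9 proved); BetaPertH ⇐ (D1) ∧ (D4) ∧ CAP+tail; G-an2-4 gates asym, D1 and NE2/3/4.

THE POINT (census sense (α); the COMPARISON column, conjecture (E58′)).  See (E65g): on a tower of ratio `≥ 10` the window budget at each age's own scale, read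
through the crude weights `√(s∕(s+k))`, bounds the transported young pressure by `(21∕20)(1∕2 − 7x∕10)`, and the λ-recursion of the dual chain is a
two-variable cubic inequality with margin `0.29`.  Here: the enumeration (minimum, predecessor map) of `A`, the derivation of (E65g)'s budget hypothesis from
the window budget offered by (E65b)∕(E65f), and the empty case.  NOT CLAIMED: ratios below `10` (numerically the dual chain closes on every tower of ratio `≥ 2`
with room — README); anything printed.

WHAT IS PROVED ([folklore]; 0 `def`, 0 sorry).  §1 `budget_crude_of_window` (the crude form of the window budget at `j = k ∈ A`).  §2
**`le_of_isotone_excess_ages_ratio_ten`** (END, Finset form).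
-/
noncomputable section
open Finset Set

namespace Summit.QuantumFields.BalabanUV.Beta.EriceRemainderEnclosureHistoryAutonomyComparisonTowerTen

open Literature.MathematicalPhysics.QuantumFieldTheory.Balaban1983to89
open Literature.MathematicalPhysics.QuantumFieldTheory.Balaban1983to89.T4BetaStationary
open Literature.MathematicalPhysics.QuantumFieldTheory.Balaban1983to89.T4BetaFlowWellPosed
open Summit.QuantumFields.BalabanUV.Beta.EriceRemainderEnclosureHistoryAutonomyComparisonLoadBudgetWindow (mul_sqrt_le_readWindow readWindow_nonneg)
open Summit.QuantumFields.BalabanUV.Beta.EriceRemainderEnclosureHistoryAutonomyComparisonBudgetedCriterion (le_of_isotone_excess_budgeted_certificate)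
open Summit.QuantumFields.BalabanUV.Beta.EriceRemainderEnclosureHistoryAutonomyComparisonDualChainCriterion (le_of_isotone_excess_of_budgeted_dual_chain)
open Summit.QuantumFields.BalabanUV.Beta.EriceRemainderEnclosureHistoryAutonomyComparisonTowerChainTen (dual_chain_of_tower_ten)

variable {B' : (ℕ → ℝ) → ℝ} {M' γ b : ℝ} {L : ℕ → ℝ} {K : ℕ} {A : Finset ℕ} {h h' : ℕ → ℝ}

/-! ## §1 The crude form of the window budget at an age's own scale -/

/-- **THE CRUDE BUDGET AT AN AGE'S OWN SCALE**: if `x ≥ 0` on `A` (ages `≥ 1`) obeys the window budget `Σ_{s∈A} x_s·W_k(s) ≤ 1∕2` at the scale `k ∈ A`, then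
`x_k·√(k∕(k+k)) + Σ_{s∈A, s<k} x_s·√(s∕(s+k)) ≤ 1∕2` — keep the ages `s ≤ k`, where `W_k(s) = S_{s,k}∕k ≥ √(s∕(s+k))` ((E65a) `mul_sqrt_le_readWindow`), drop the
older ones. [folklore] -/
theorem budget_crude_of_window {x : ℕ → ℝ} {k : ℕ} (hA1 : ∀ s ∈ A, 1 ≤ s) (hx : ∀ s ∈ A, 0 ≤ x s) (hk : k ∈ A)
    (hbud : ∑ s ∈ A, x s * (if s ≤ k then (∑ l ∈ range k, Real.sqrt ((s : ℝ) / ((s : ℝ) + l + 1))) / k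
        else (∑ l ∈ range k, Real.sqrt ((s : ℝ) / ((s : ℝ) + l + 1))) / s) ≤ 1 / 2) :
    x k * Real.sqrt ((k : ℝ) / ((k : ℝ) + k)) + ∑ s ∈ A.filter (fun s => s < k), x s * Real.sqrt ((s : ℝ) / ((s : ℝ) + k)) ≤ 1 / 2 := by
  have hkr : (0 : ℝ) < k := by exact_mod_cast hA1 k hk
  -- termwise comparison with f s := x s √(s/(s+k)) for s ≤ k, 0 otherwise
  have hterm : ∀ s ∈ A, (if s ≤ k then x s * Real.sqrt ((s : ℝ) / ((s : ℝ) + k)) else 0) ≤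
      x s * (if s ≤ k then (∑ l ∈ range k, Real.sqrt ((s : ℝ) / ((s : ℝ) + l + 1))) / k
        else (∑ l ∈ range k, Real.sqrt ((s : ℝ) / ((s : ℝ) + l + 1))) / s) := by
    intro s hs
    by_cases hsk : s ≤ k
    · rw [if_pos hsk, if_pos hsk]
      refine mul_le_mul_of_nonneg_left ?_ (hx s hs)
      rw [le_div_iff₀ hkr, mul_comm]
      exact mul_sqrt_le_readWindow s k
    · rw [if_neg hsk, if_neg hsk]
      have := readWindow_nonneg s k; have := hx s hs
      positivity
  have hsum := (sum_le_sum hterm).trans hbud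
  -- the left side: split A into the ages ≤ k (= {k} ∪ {s < k}) and the rest
  have hsplit : ∑ s ∈ A, (if s ≤ k then x s * Real.sqrt ((s : ℝ) / ((s : ℝ) + k)) else 0) =
      x k * Real.sqrt ((k : ℝ) / ((k : ℝ) + k)) + ∑ s ∈ A.filter (fun s => s < k), x s * Real.sqrt ((s : ℝ) / ((s : ℝ) + k)) := by
    rw [← sum_filter]
    have hset : A.filter (fun s => s ≤ k) = insert k (A.filter (fun s => s < k)) := by
      ext s; simp only [mem_filter, Finset.mem_insert]
      constructor
      · rintro ⟨hs, hsk⟩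
        rcases lt_or_eq_of_le hsk with h1 | h1
        · exact Or.inr ⟨hs, h1⟩
        · exact Or.inl h1
      · rintro (rfl | ⟨hs, hsk⟩)
        · exact ⟨hk, le_rfl⟩
        · exact ⟨hs, hsk.le⟩
    have hnot : k ∉ A.filter (fun s => s < k) := by simp
    rw [hset, sum_insert hnot]
  rw [hsplit] at hsum
  exact hsum

/-! ## §2 END: towers of ratio `≥ 10`, any height, any sizes -/

/-- **EVERY FINITE SET OF AGES WITH PAIRWISE RATIOS `≥ 10` COMPARES AT ANY SIZE, WHATEVER ITS CARDINALITY.**  `B(u) = b + Σ_{k<K} L_k·u_k` on ]0,γ] with `b > 0`,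
`L ≥ 0` supported on `{0} ∪ A`, `A ⊆ [1, K[` with **`10·k ≤ k′` for `k < k′` in `A`** — `#A`, the sizes `L_k` AND the Markov weight `L_0` ARBITRARY; `B′` with
zeroth moment `M′ ≥ 0`, `B ≤ B′`, ISOTONE excess; `h`, `h′` ANY box solutions from one pin `p ∈ ]0,γ]`.  Then `h′ ≤ h` at EVERY scale ((E65f) with the chain
of (E65g); (E64h) `le_of_isotone_excess_ages_ratio_fourteen` needed `14`). [folklore] -/
theorem le_of_isotone_excess_ages_ratio_ten {p : ℝ} (hL : ∀ k, 0 ≤ L k) (hb : 0 < b) (hAK : A ⊆ range K) (hA1 : ∀ k ∈ A, 1 ≤ k)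
    (hsupp : ∀ k ∈ range K, k ∉ A → k ≠ 0 → L k = 0) (hsep : ∀ k ∈ A, ∀ k' ∈ A, k < k' → 10 * k ≤ k')
    (hB' : ∀ u u' : ℕ → ℝ, SeqBox γ u → SeqBox γ u' → ∀ D : ℝ, (∀ j, |u j - u' j| ≤ D) → |B' u - B' u'| ≤ M' * D) (hM' : 0 ≤ M')
    (hexc : ∀ u, SeqBox γ u → (fun u : ℕ → ℝ => b + ∑ k ∈ range K, L k * u k) u ≤ B' u)
    (hDmono : ∀ u v : ℕ → ℝ, SeqBox γ u → SeqBox γ v → (∀ j, u j ≤ v j) →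
      B' u - (fun u : ℕ → ℝ => b + ∑ k ∈ range K, L k * u k) u ≤ B' v - (fun u : ℕ → ℝ => b + ∑ k ∈ range K, L k * u k) v)
    (hp : 0 < p) (hpγ : p ≤ γ) (hh : SeqBox γ h) (hf : MemFlow (fun u : ℕ → ℝ => b + ∑ k ∈ range K, L k * u k) p h)
    (hh' : SeqBox γ h') (hf' : MemFlow B' p h') (j : ℕ) : h' j ≤ h j := by
  classical
  rcases A.eq_empty_or_nonempty with hA | hA
  · -- no age: the empty certificate
    subst hA
    exact le_of_isotone_excess_budgeted_certificate hL hb hAK hA1 hsupp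
      (fun x _ _ _ => ⟨fun _ => 0, fun _ h => absurd h (Finset.notMem_empty _), fun _ h => absurd h (Finset.notMem_empty _), by simp⟩)
      hB' hM' hexc hDmono hp hpγ hh hf hh' hf' j
  · -- the enumeration of A: minimum and predecessor map
    set m₀ := A.min' hA with hm₀_def
    have hm₀ : m₀ ∈ A := min'_mem A hA
    have hmin : ∀ k ∈ A, m₀ ≤ k := fun k hk => min'_le A k hk
    set pred : ℕ → ℕ := fun k => if hne : (A.filter (fun s => s < k)).Nonempty then (A.filter (fun s => s < k)).max' hne else 0
      with hpred_def
    have hpred : ∀ k ∈ A, k ≠ m₀ → pred k ∈ A ∧ pred k < k ∧ ∀ k'' ∈ A, k'' < k → k'' ≤ pred k := by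
      intro k hk hkm
      have hlt : m₀ < k := lt_of_le_of_ne (hmin k hk) (Ne.symm hkm)
      have hne : (A.filter (fun s => s < k)).Nonempty := ⟨m₀, mem_filter.mpr ⟨hm₀, hlt⟩⟩
      have hpk : pred k = (A.filter (fun s => s < k)).max' hne := by simp only [hpred_def, dif_pos hne]
      have hmem := max'_mem _ hne
      rw [← hpk] at hmem
      refine ⟨(mem_filter.mp hmem).1, (mem_filter.mp hmem).2, fun k'' hk'' hlt'' => ?_⟩
      rw [hpk]; exact le_max' _ _ (mem_filter.mpr ⟨hk'', hlt''⟩)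
    have hten : ∀ k ∈ A, k ≠ m₀ → 10 * pred k ≤ k := fun k hk hkm => by
      obtain ⟨hpA, hplt, _⟩ := hpred k hk hkm
      exact hsep _ hpA _ hk hplt
    refine le_of_isotone_excess_of_budgeted_dual_chain hL hb hAK hA1 hsupp hm₀ hmin hpred (fun x hx _ hbud => ?_)
      hB' hM' hexc hDmono hp hpγ hh hf hh' hf' j
    exact dual_chain_of_tower_ten hA1 hx hm₀ hmin hpred hten
      (fun k hk => budget_crude_of_window hA1 hx hk (hbud k (hA1 k hk)))

end Summit.QuantumFields.BalabanUV.Beta.EriceRemainderEnclosureHistoryAutonomyComparisonTowerTen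

end
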